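import Literature.NumberTheory.EllipticCurves.IwasawaNakayamaProofs
import Literature.NumberTheory.EllipticCurves.PrimaryTorsionGaloisRep
import Literature.NumberTheory.EllipticCurves.PointDivisibilityProofs
import Literature.NumberTheory.EllipticCurves.GaloisActionProofs
import Literature.NumberTheory.IwasawaTheory.Greenberg2006.CoinducedModuleDual
import Mathlib.Algebra.Module.CharacterModule
import HarnessLib

/-!
# `E[p^∞]` is a COFREE `ℤ_p`-module: its Pontryagin dual `Hom(E[p^∞], ℚ/ℤ)` is finite free over `ℤ_p`
# (half of the registered stub `stub_primaryTorsionCofreeSS` of line `bdpline`, crux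
# `AnticyclotomicEisensteinDivisibility`, stmt-BirchSwinnertonDyer-20727; the hypothesis `hcofree` of
# `SignedBaseChangeAcDivAssembly.fullAtSelmer_isAlmostDivisible_curve`)

Lead seat bsd-line-sbc-p1 gen 3 (2026-08-28). For an elliptic curve `W` over any field `K` (e.g. a number field) and
any prime `p`, the Pontryagin dual `X = Hom(E[p^∞], ℚ/ℤ)` (Mathlib `CharacterModule`, with the
`ℤ_p`-structure induced from the tree's `PrimaryTorsion W.geomPoints p`) is
* FINITELY GENERATED over `ℤ_p` (`module_finite_characterModule`): the tree's Nakayama lemma for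
  Pontryagin duals over `Λ = ℤ_p⟦T⟧` (`IwasawaDual.IsDualPair.module_finite`, Greenberg LNM 1716 §1
  p. 60) applied with the ZERO endomorphism (`T` acting as `0`, `Λ → ℤ_p` the constant term): the
  finiteness input is `E[p]` finite (`finite_torsionPoints_holds`);
* TORSION-FREE (`noZeroSMulDivisors_characterModule`): `E(K̄)` is divisible
  (`zsmul_geomPoints_surjective_holds`), so every non-zero `c ∈ ℤ_p` acts onto `E[p^∞]`;
hence FREE (`ℤ_p` is a PID), and `E[p^∞]` is cofree in Greenberg's sense (`isCofree_primaryTorsion`,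
cofreeness being read on one dual datum, `isCofree_of_isDualPairing`). ("`E_{ℓ^∞} ≅ (ℚ_ℓ/ℤ_ℓ)²`",
Silverman III.7; the rank, `= 2` by the tree's `finrank_tateModule_eq_two_holds` and
`finrank_quotientTorsion_characterModule_eq_finrank_tateModule`, is not needed here.)

Theorems only (no definition, no named fact, no `sorry`); route-independent. The Tate-dual half of
the stub (`hTate`: a `K̄ˣ`-valued dual with a finite basis) is NOT proved here. BSD is not proved by
any of this.

References: J. H. Silverman, *AEC* (2009), III.§7; R. Greenberg, LNM 1716 (1999), §1 p. 60;
R. Greenberg, *On the structure of Selmer groups* (2016), §2 p. 5 ("cofree"); S. Lang, *Cyclotomic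
Fields I–II*, Ch. 5 §1.
-/

-- D-0017: single-problem summit, the namespace repeats the problem name by design.
set_option linter.dupNamespace false
set_option autoImplicit false

noncomputable section

open scoped Classical

open Literature.NumberTheory.EllipticCurves Literature.NumberTheory.IwasawaTheory.Greenberg2016

namespace Summit.BirchSwinnertonDyer.BirchSwinnertonDyer.Theorems.SignedBaseChangeAcDivPrimaryTorsionCofree

variable {K : Type} [Field K] (W : WeierstrassCurve K) [W.IsElliptic] (p : ℕ) [Fact p.Prime]

/-! ## §1 Divisibility and finiteness inputs -/

/-- **`E[p^∞]` is `p`-divisible**: for `a ∈ E[p^∞]` and every `m` there is `b ∈ E[p^∞]` with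
`p^m·b = a` (`E(K̄)` is divisible, `zsmul_geomPoints_surjective_holds`; `b` is again `p`-power torsion).
[cite: SilvermanAEC2009, III.§4 Thm. 4.10 (multiplication by `m` is surjective on `E(K̄)`)] -/
theorem exists_pow_smul_eq (a : PrimaryTorsion W.geomPoints p) (m : ℕ) :
    ∃ b : PrimaryTorsion W.geomPoints p, p ^ m • b = a := by
  obtain ⟨k, hk⟩ := a.exists_pow_smul_eq_zero
  have hpm : ((p ^ m : ℕ) : ℤ) ≠ 0 := by exact_mod_cast pow_ne_zero m (Fact.out : p.Prime).ne_zero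
  obtain ⟨B, hB⟩ := W.zsmul_geomPoints_surjective_holds hpm (a : W.geomPoints)
  have hB' : p ^ m • B = (a : W.geomPoints) := by
    have := hB
    simp only [natCast_zsmul] at this
    exact this
  refine ⟨PrimaryTorsion.mk B (k + m) ?_, PrimaryTorsion.ext ?_⟩
  · rw [pow_add, mul_smul, hB', hk]
  · rw [PrimaryTorsion.val_nsmul]
    exact hB'

/-- Every non-zero `c ∈ ℤ_p` acts ONTO `E[p^∞]` (`c = u·p^m` with `u` a unit). [cite: SilvermanAEC2009, III.§4 Thm. 4.10] -/
theorem smul_surjective_of_ne_zero {c : ℤ_[p]} (hc : c ≠ 0) :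
    Function.Surjective fun a : PrimaryTorsion W.geomPoints p ↦ c • a := by
  intro a
  obtain ⟨b, hb⟩ := exists_pow_smul_eq W p ((↑(PadicInt.unitCoeff hc)⁻¹ : ℤ_[p]) • a) c.valuation
  refine ⟨b, ?_⟩
  show c • b = a
  rw [PadicInt.unitCoeff_spec hc, mul_smul, ← Nat.cast_pow, PrimaryTorsion.natCast_smul, hb, ← mul_smul,
    Units.mul_inv, one_smul]

/-- `E[p^∞][p]` is finite (it embeds in `E[p]`). [cite: SilvermanAEC2009, Cor. III.6.4] -/
theorem finite_setOf_p_smul_eq_zero :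
    {s : PrimaryTorsion W.geomPoints p | p • s = 0}.Finite := by
  have hp0 : ((p : ℕ) : ℤ) ≠ 0 := by exact_mod_cast (Fact.out : p.Prime).ne_zero
  haveI : Finite (W.geomTorsion ((p : ℕ) : ℤ)) := W.finite_torsionPoints_holds (AlgebraicClosure K) hp0
  let f : {s : PrimaryTorsion W.geomPoints p | p • s = 0} → W.geomTorsion ((p : ℕ) : ℤ) :=
    fun s ↦ ⟨((s : PrimaryTorsion W.geomPoints p) : W.geomPoints), by
      rw [AddSubgroup.torsionBy.nsmul_iff]
      have h := s.2
      simp only [Set.mem_setOf_eq] at h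
      have := congrArg (fun z : PrimaryTorsion W.geomPoints p ↦ (z : W.geomPoints)) h
      simpa only [PrimaryTorsion.val_nsmul, PrimaryTorsion.val_zero] using this⟩
  refine Set.finite_coe_iff.mp (Finite.of_injective f fun a b hab ↦ ?_)
  have h := congrArg Subtype.val hab
  exact Subtype.ext (PrimaryTorsion.ext h)

/-! ## §2 The Pontryagin dual is finitely generated, torsion-free, free -/

/-- **`Hom(E[p^∞], ℚ/ℤ)` is a finitely generated `ℤ_p`-module** — Nakayama for Pontryagin duals
(tree `IwasawaDual.IsDualPair.module_finite`) over `Λ = ℤ_p⟦T⟧` with `T` acting as the ZERO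
endomorphism (the `Λ`-structure through the constant term `Λ → ℤ_p`); the finiteness input is
`E[p^∞][p]` finite. [cite: GreenbergLNM1716, §1 p. 60 (Nakayama for profinite Λ-modules)] [cite: SilvermanAEC2009, III.§7] -/
theorem module_finite_characterModule :
    Module.Finite ℤ_[p] (CharacterModule (PrimaryTorsion W.geomPoints p)) := by
  classical
  set S := PrimaryTorsion W.geomPoints p
  letI instΛ : Module (PowerSeries ℤ_[p]) (CharacterModule S) :=
    Module.compHom (CharacterModule S) (PowerSeries.constantCoeff (R := ℤ_[p]))
  have hsmul : ∀ (r : PowerSeries ℤ_[p]) (x : CharacterModule S),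
      (r • x : CharacterModule S) = (PowerSeries.constantCoeff (R := ℤ_[p]) r) • x := fun _ _ ↦ rfl
  -- the axiomatic dual pair with `ψ = 0`
  have hpair : IwasawaDual.IsDualPair p (0 : AddMonoid.End S)
      (AddMonoidHom.id (CharacterModule S) : CharacterModule S →+ (S →+ AddCircle (1 : ℚ))) := by
    refine ⟨Function.bijective_id, fun x s ↦ ?_, fun c x s k hk ↦ ?_, ⟨fun s ↦ ?_, fun s ↦ ⟨1, ?_⟩⟩⟩
    · show ((PowerSeries.X : PowerSeries ℤ_[p]) • x : CharacterModule S) s = x ((0 : AddMonoid.End S) s)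
      rw [hsmul, PowerSeries.constantCoeff_X, zero_smul, AddMonoid.End.zero_apply, map_zero]
      rfl
    · show ((PowerSeries.C c : PowerSeries ℤ_[p]) • x : CharacterModule S) s = (PadicInt.toZModPow k c).val • x s
      rw [hsmul, PowerSeries.constantCoeff_C, CharacterModule.smul_apply]
      have hk' : p ^ k • (s : W.geomPoints) = 0 := by
        rw [← PrimaryTorsion.val_nsmul, hk, PrimaryTorsion.val_zero]
      have e : c • s = (PadicInt.toZModPow k c).val • s :=
        PrimaryTorsion.ext (by rw [PrimaryTorsion.val_smul_eq_zpT c s hk', IwasawaDual.zpT_def,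
          PrimaryTorsion.val_nsmul])
      rw [e, map_nsmul]
    · obtain ⟨k, hk⟩ := s.exists_pow_smul_eq_zero
      exact ⟨k, PrimaryTorsion.ext (by rw [PrimaryTorsion.val_nsmul, PrimaryTorsion.val_zero]; exact hk)⟩
    · rw [pow_one, AddMonoid.End.zero_apply]
  have hfin : (IwasawaDual.piece p (0 : AddMonoid.End S) 1 : Set S).Finite := by
    refine (finite_setOf_p_smul_eq_zero W p).subset fun s hs ↦ ?_
    have h := (IwasawaDual.mem_piece.mp hs).1
    rw [pow_one] at h
    exact h
  have hΛ : Module.Finite (PowerSeries ℤ_[p]) (CharacterModule S) := hpair.module_finite hfin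
  -- descend finite generation along `Λ → ℤ_p`
  obtain ⟨t, ht⟩ := Module.Finite.fg_top (R := PowerSeries ℤ_[p]) (M := CharacterModule S)
  refine ⟨⟨t, ?_⟩⟩
  rw [eq_top_iff]
  intro x _
  have hx : x ∈ Submodule.span (PowerSeries ℤ_[p]) (t : Set (CharacterModule S)) := by
    rw [ht]; exact Submodule.mem_top
  refine Submodule.span_induction (p := fun y _ ↦ y ∈ Submodule.span ℤ_[p] (t : Set (CharacterModule S)))
    (fun y hy ↦ Submodule.subset_span hy) (Submodule.zero_mem _) (fun y z _ _ hy hz ↦ Submodule.add_mem _ hy hz)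
    (fun r y _ hy ↦ ?_) hx
  rw [hsmul]
  exact Submodule.smul_mem _ _ hy

/-- **`Hom(E[p^∞], ℚ/ℤ)` is torsion-free over `ℤ_p`**: a non-zero `c` acts onto `E[p^∞]`
(`smul_surjective_of_ne_zero`), so `c·χ = 0` forces `χ = 0`. [cite: SilvermanAEC2009, III.§7] -/
theorem noZeroSMulDivisors_characterModule :
    NoZeroSMulDivisors ℤ_[p] (CharacterModule (PrimaryTorsion W.geomPoints p)) := by
  refine ⟨fun {c x} h ↦ ?_⟩
  by_cases hc : c = 0
  · exact Or.inl hc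
  · refine Or.inr ?_
    apply AddMonoidHom.ext
    intro a
    obtain ⟨b, rfl⟩ := smul_surjective_of_ne_zero W p hc a
    have := DFunLike.congr_fun h b
    rw [CharacterModule.smul_apply] at this
    exact this

/-- **`Hom(E[p^∞], ℚ/ℤ)` is a free `ℤ_p`-module** (finitely generated and torsion-free over a PID).
[cite: SilvermanAEC2009, III.§7 (`E[p^∞] ≅ (ℚ_p/ℤ_p)²`)] -/
theorem module_free_characterModule :
    Module.Free ℤ_[p] (CharacterModule (PrimaryTorsion W.geomPoints p)) := by
  haveI := module_finite_characterModule W p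
  haveI := noZeroSMulDivisors_characterModule W p
  exact Module.free_of_finite_type_torsion_free'

/-! ## §3 `E[p^∞]` is cofree -/

/-- **`E[p^∞]` is a COFREE `ℤ_p`-module** (every Pontryagin dual finite free): the hypothesis
`hcofree` of `SignedBaseChangeAcDivAssembly.fullAtSelmer_isAlmostDivisible_curve`, i.e. the first
conjunct of the registered stub `stub_primaryTorsionCofreeSS` (bdpline v19).
[cite: Greenberg2016Selmer, §2 p. 5 ("cofree"), §4.1 Prop. 4.1.1 (b)] [cite: SilvermanAEC2009, III.§7] -/
theorem isCofree_primaryTorsion : IsCofree ℤ_[p] (PrimaryTorsion W.geomPoints p) := by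
  haveI := module_finite_characterModule W p
  haveI := module_free_characterModule W p
  exact isCofree_of_isDualPairing (isDualPairing_characterModule ℤ_[p] (PrimaryTorsion W.geomPoints p))

end Summit.BirchSwinnertonDyer.BirchSwinnertonDyer.Theorems.SignedBaseChangeAcDivPrimaryTorsionCofree

end
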